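import Literature.Probability.Percolation.ArmSeparationSpoke
import HarnessLib

/-!
# The spoke–ring junction, generic form

Topic `Literature/Probability/Percolation`; family `crit-perc` / near-critical percolation on `𝕋`.
A brick of the near-critical arm-separation theorem for four arms in the ADJACENT colour
arrangement (P. Nolin, EJP 13 (2008), Thm. 11, `j = 4`, `σ = BBWW` [arXiv 0711.4948: Thm. 10]),
landing step. The tree's `arm_to_entry` / `trapArm_to_entry` glue a fenced arm, through its beacon
and spoke, to an entry tube of the original frame; here the junction alone, for ANY horizontal tube
`Sp` of the frame `i < 6` crossed in `frameConfig i χ` and any tube `E` of the original frame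
crossed in `χ` with `SpokeMeets i Sp E`: every crossing of `Sp` (read in the original frame) is
joined to the start of the crossing of `E` inside `frameIso i '' Sp.box ∪ E.box`
(`spoke_junction`; the six frames as in `arm_to_entry`). Everything here is proved.

## References

* P. Nolin, Near-critical percolation in two dimensions, *Electron. J. Probab.* 13 (2008), §4.3
  Prop. 12 (proof) (arXiv 0711.4948: Prop. 11) [Nolin2008].
* H. Kesten, *Percolation theory for mathematicians* (1982), §2.2 [KestenPTM1982].
-/

noncomputable section

open Set

namespace Literature.Probability.Percolation

open LatticeModels Tube

/-- **The spoke–entry junction.** See the module docstring. [cite: Nolin2008, §4.3 Prop. 12 (proof) (arXiv 0711.4948: Prop. 11)] [cite: KestenPTM1982, §2.2] -/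
theorem spoke_junction {i : ℕ} (hi : i < 6) {Sp E : Tube} (hSph : Sp.horiz = true) {χ : SiteConfig (Site 2)}
    {x' y' : Site 2} (hcr : Sp.IsCrossing (frameConfig i χ) x' y')
    {xE yE : Site 2} (hE : E.IsCrossing χ xE yE) (hJ : SpokeMeets i Sp E) :
    PathIn triGraph ((frameIso i '' Sp.box ∪ E.box) ∩ χ) (frameIso i x') xE := by
  -- (1) the crossing of the spoke, read in the original frame, with a tight support
  obtain ⟨hs, P'⟩ := hcr
  rw [hSph] at hs
  simp only [cond_true] at hs
  have hx'b : x' ∈ Sp.box := P'.left_mem.1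
  have hy'b : y' ∈ Sp.box := P'.right_mem.1
  rw [Tube.mem_box] at hx'b hy'b
  have Pphys : PathIn triGraph ((frameIso i '' Sp.box) ∩ {v | v ∈ χ ↔ true}) (frameIso i x') (frameIso i y') :=
    pathIn_of_frameConfig i (P'.mono fun v hv => ⟨hv.1, by simpa using hv.2⟩)
  obtain ⟨S, hS, PS, TS⟩ := Pphys.exists_support
  have hSχ : S ⊆ χ := fun v hv => by simpa using (hS hv).2
  have star : ∀ u ∈ S, ∀ v ∈ S, PathIn triGraph S u v := fun u hu v hv => (TS u hu).symm.trans (TS v hv)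
  -- (2) the spoke meets the crossing of `E`
  obtain ⟨SE, hSE, PE, TE⟩ := hE.2.exists_support
  have physS : ∀ v ∈ S, ∃ u ∈ Sp.box, frameIso i u = v := fun v hv => by
    obtain ⟨⟨u, hu, huv⟩, -⟩ := hS hv; exact ⟨u, hu, huv⟩
  have hEbox : ∀ z ∈ SE, E.a ≤ z 0 ∧ z 0 ≤ E.a + E.w ∧ E.b ≤ z 1 ∧ z 1 ≤ E.b + E.h := fun z hz =>
    (Tube.mem_box E).1 (hSE hz).1
  have hE1 := hE.1
  have meet : ∃ z, z ∈ S ∧ z ∈ SE := by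
    interval_cases i
    · obtain ⟨hEh, h1, h2, h3, h4⟩ := hJ
      rw [hEh] at hE1
      obtain ⟨hxE, hyE⟩ : xE 1 = E.b ∧ yE 1 = E.b + E.h := hE1
      obtain ⟨fx0, -⟩ := frameIso_apply_formula x'
      obtain ⟨fy0, -⟩ := frameIso_apply_formula y'
      refine exists_mem_of_cross (L := E.a) (R := E.a + E.w) (B := E.b) (T := E.b + E.h) (by omega) (by omega)
        PS (by rw [fx0]; omega) (by rw [fy0]; omega) (fun z hz _ _ => ?_) PE (by omega) (by omega)
        (fun z hz _ _ => ⟨(hEbox z hz).1, (hEbox z hz).2.1⟩)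
      obtain ⟨u, hu, rfl⟩ := physS z hz
      obtain ⟨g0, g1, -⟩ := frameIso_apply_formula u
      rw [Tube.mem_box] at hu; rw [g0, g1] at *; constructor <;> omega
    · obtain ⟨hEh, h1, h2, h3, h4⟩ := hJ
      rw [hEh] at hE1
      obtain ⟨hxE, hyE⟩ : xE 0 = E.a ∧ yE 0 = E.a + E.w := hE1
      obtain ⟨-, -, fx0, fx1, -⟩ := frameIso_apply_formula x'
      obtain ⟨-, -, fy0, fy1, -⟩ := frameIso_apply_formula y'
      obtain ⟨z, hzE, hzS⟩ := exists_mem_of_cross (L := -(Sp.b + Sp.h)) (R := -Sp.b) (B := E.b) (T := E.b + E.h)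
        (by omega) (by omega) PE (by omega) (by omega) (fun z hz _ _ => ⟨(hEbox z hz).2.2.1, (hEbox z hz).2.2.2⟩)
        PS (by rw [fx1]; omega) (by rw [fy1]; omega) (fun z hz _ _ => by
          obtain ⟨u, hu, rfl⟩ := physS z hz
          obtain ⟨-, -, g0, g1, -⟩ := frameIso_apply_formula u
          rw [Tube.mem_box] at hu; rw [g0]; constructor <;> omega)
      exact ⟨z, hzS, hzE⟩
    · obtain ⟨hEh, h1, h2, h3, h4⟩ := hJ
      rw [hEh] at hE1
      obtain ⟨hxE, hyE⟩ : xE 0 = E.a ∧ yE 0 = E.a + E.w := hE1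
      obtain ⟨-, -, -, -, fx0, fx1, -⟩ := frameIso_apply_formula x'
      obtain ⟨-, -, -, -, fy0, fy1, -⟩ := frameIso_apply_formula y'
      obtain ⟨z, hzE, hzS⟩ := exists_mem_of_cross (L := Sp.b) (R := Sp.b + Sp.h) (B := E.b) (T := E.b + E.h)
        (by omega) (by omega) PE (by omega) (by omega) (fun z hz _ _ => ⟨(hEbox z hz).2.2.1, (hEbox z hz).2.2.2⟩)
        PS (by rw [fx1]; omega) (by rw [fy1]; omega) (fun z hz _ _ => by
          obtain ⟨u, hu, rfl⟩ := physS z hz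
          obtain ⟨-, -, -, -, g0, g1, -⟩ := frameIso_apply_formula u
          rw [Tube.mem_box] at hu; rw [g0]; constructor <;> omega)
      exact ⟨z, hzS, hzE⟩
    · obtain ⟨hEh, h1, h2, h3, h4⟩ := hJ
      rw [hEh] at hE1
      obtain ⟨hxE, hyE⟩ : xE 1 = E.b ∧ yE 1 = E.b + E.h := hE1
      obtain ⟨-, -, -, -, -, -, fx0, fx1, -⟩ := frameIso_apply_formula x'
      obtain ⟨-, -, -, -, -, -, fy0, fy1, -⟩ := frameIso_apply_formula y'
      refine exists_mem_of_cross (L := E.a) (R := E.a + E.w) (B := E.b) (T := E.b + E.h) (by omega) (by omega)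
        PS.symm (by rw [fy0]; omega) (by rw [fx0]; omega) (fun z hz _ _ => ?_) PE (by omega) (by omega)
        (fun z hz _ _ => ⟨(hEbox z hz).1, (hEbox z hz).2.1⟩)
      obtain ⟨u, hu, rfl⟩ := physS z hz
      obtain ⟨-, -, -, -, -, -, g0, g1, -⟩ := frameIso_apply_formula u
      rw [Tube.mem_box] at hu; rw [g1]; constructor <;> omega
    · obtain ⟨hEh, h1, h2, h3, h4⟩ := hJ
      rw [hEh] at hE1
      obtain ⟨hxE, hyE⟩ : xE 0 = E.a ∧ yE 0 = E.a + E.w := hE1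
      obtain ⟨-, -, -, -, -, -, -, -, fx0, fx1, -⟩ := frameIso_apply_formula x'
      obtain ⟨-, -, -, -, -, -, -, -, fy0, fy1, -⟩ := frameIso_apply_formula y'
      obtain ⟨z, hzE, hzS⟩ := exists_mem_of_cross (L := Sp.b) (R := Sp.b + Sp.h) (B := E.b) (T := E.b + E.h)
        (by omega) (by omega) PE (by omega) (by omega) (fun z hz _ _ => ⟨(hEbox z hz).2.2.1, (hEbox z hz).2.2.2⟩)
        PS.symm (by rw [fy1]; omega) (by rw [fx1]; omega) (fun z hz _ _ => by
          obtain ⟨u, hu, rfl⟩ := physS z hz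
          obtain ⟨-, -, -, -, -, -, -, -, g0, g1, -⟩ := frameIso_apply_formula u
          rw [Tube.mem_box] at hu; rw [g0]; constructor <;> omega)
      exact ⟨z, hzS, hzE⟩
    · obtain ⟨hEh, h1, h2, h3, h4⟩ := hJ
      rw [hEh] at hE1
      obtain ⟨hxE, hyE⟩ : xE 0 = E.a ∧ yE 0 = E.a + E.w := hE1
      obtain ⟨-, -, -, -, -, -, -, -, -, -, fx0, fx1⟩ := frameIso_apply_formula x'
      obtain ⟨-, -, -, -, -, -, -, -, -, -, fy0, fy1⟩ := frameIso_apply_formula y'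
      obtain ⟨z, hzE, hzS⟩ := exists_mem_of_cross (L := -(Sp.b + Sp.h)) (R := -Sp.b) (B := E.b) (T := E.b + E.h)
        (by omega) (by omega) PE (by omega) (by omega) (fun z hz _ _ => ⟨(hEbox z hz).2.2.1, (hEbox z hz).2.2.2⟩)
        PS.symm (by rw [fy1]; omega) (by rw [fx1]; omega) (fun z hz _ _ => by
          obtain ⟨u, hu, rfl⟩ := physS z hz
          obtain ⟨-, -, -, -, -, -, -, -, -, -, g0, g1⟩ := frameIso_apply_formula u
          rw [Tube.mem_box] at hu; rw [g0]; constructor <;> omega)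
      exact ⟨z, hzS, hzE⟩
  -- (3) assemble
  obtain ⟨z, hzS, hzE⟩ := meet
  have Q2 : PathIn triGraph ((frameIso i '' Sp.box ∪ E.box) ∩ χ) (frameIso i x') z := by
    refine (star _ PS.left_mem z hzS).mono fun v hv => ?_
    obtain ⟨u, hu, rfl⟩ := physS v hv
    exact ⟨Or.inl ⟨u, hu, rfl⟩, hSχ hv⟩
  have Q3 : PathIn triGraph ((frameIso i '' Sp.box ∪ E.box) ∩ χ) z xE :=
    (TE z hzE).symm.mono fun v hv => ⟨Or.inr (hSE hv).1, (hSE hv).2⟩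
  exact Q2.trans Q3

end Literature.Probability.Percolation
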